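import Summits.QuantumFields.GaugeBoot.SlabKernelChain
import HarnessLib

/-!
# Integrating out all rungs of a closed annulus of `2m` plaquettes (gauge-boot, L3 supplement: 2D slab gluing 4b/6)

HONEST FRAMING (cell `pub-gaugeboot`, page 1 of every file): the venture produces certified bounds
on lattice expectations at stated coupling, gauge group, dimension and torus size; NOT a mass gap,
NOT a continuum limit, NOT a string tension; NOT Yang–Mills-summit-bearing (barriers
`FixedCouplingUltralocality`, `PerturbativeInvisibility`). Measure-theoretic bookkeeping for the
POSITIVE two-dimensional result `TiltedBoxOddAxisRPTwoDim.lean`; it discharges nothing else.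

Continuation of `SlabKernelChain.lean` (same setting: product Haar measure on `ι → G`, central
continuous weight `ω`, rungs `r t`, frozen neighbours `a t, b t`).

**`integral_mul_annulus`.** For a CLOSED annulus of `2m` plaquettes (`r (2m) = r 0`, the rungs
`r 0, …, r (2m-1)` distinct, `m ≥ 1`) and a bounded measurable factor `h` frozen along all rungs,
`∫ h · ∏_{t<2m} ω(a_t U(r(t+1)) b_t⁻¹ U(r t)⁻¹) dμ = ∫ h · k_{ω^{⋆m}}(a_0⋯a_{2m-1}, b_0⋯b_{2m-1}) dμ`
with the slab kernel `k_ψ(α, β) = ∫ (ψ ⋆ ψ)(α x β⁻¹ x⁻¹) dx` of `SlabKernelGram.lean`: two open chains of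
length `m` (`integral_mul_openChain`), the rung `r m` (one more `integral_mul_conv_step`), and the
rung `r 0` (the class average). Because the number of plaquettes around the annulus is EVEN, the
result is the class-averaged convolution SQUARE of `ω^{⋆m}`, a kernel of positive type by
`SlabKernel.slabKernel_eq_integral_featureMap` — with no hypothesis on the sign of `ω`'s Fourier
coefficients. [folklore] (Migdal 1975; Driver 1989 §7.)
-/

noncomputable section

open MeasureTheory Filter Function
open Literature.MathematicalPhysics.QuantumLattice
open Literature.MathematicalPhysics.QuantumFieldTheory (haarProbability)
open Literature.MathematicalPhysics.QuantumFieldTheory.LatticeRP (piMeasure)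

namespace Summit.QuantumFields.GaugeBoot

namespace SlabKernel

variable {ι : Type*} [Fintype ι] [DecidableEq ι]
variable {G : Type*} [Group G] [TopologicalSpace G] [IsTopologicalGroup G] [CompactSpace G]
  [MeasurableSpace G] [BorelSpace G]

variable {ω : G → ℝ} {r : ℕ → ι} {a b : ℕ → (ι → G) → G}

omit [Fintype ι] [TopologicalSpace G] [IsTopologicalGroup G] [CompactSpace G] [MeasurableSpace G] [BorelSpace G] in
/-- A plaquette weight does not see a link which is neither of its rungs (frozen neighbours). [folklore] -/
theorem plaqWt_update_of_ne {l : ι} {t : ℕ} (h1 : r (t + 1) ≠ l) (h0 : r t ≠ l)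
    (hau : ∀ U z, a t (update U l z) = a t U) (hbu : ∀ U z, b t (update U l z) = b t U) (U : ι → G) (z : G) :
    plaqWt ω r a b t (update U l z) = plaqWt ω r a b t U := by
  simp only [plaqWt, hau, hbu, update_of_ne h1, update_of_ne h0]

omit [Fintype ι] [DecidableEq ι] [TopologicalSpace G] [IsTopologicalGroup G] [CompactSpace G] [MeasurableSpace G]
  [BorelSpace G] in
/-- The plaquettes `m, …, 2m-1` of the annulus are the plaquettes of the SHIFTED chain `t ↦ m + t`. [folklore] -/
theorem plaqWt_shift (m s : ℕ) (U : ι → G) :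
    plaqWt ω r a b (m + s) U = plaqWt ω (fun t => r (m + t)) (fun t => a (m + t)) (fun t => b (m + t)) s U := by
  simp only [plaqWt, Nat.add_succ]

variable [SecondCountableTopology G]

/-- **The closed annulus.** Integrating all `2m` rungs of a closed annulus of `2m ≥ 2` plaquettes,
against a bounded measurable factor `h` frozen along the rungs, leaves the slab kernel of the two
ordered products of frozen neighbours: `∫ h ∏_{t<2m} plaqWt_t dμ = ∫ h · k_{ω^{⋆m}}(∏ a_t, ∏ b_t) dμ`.
[folklore] -/
theorem integral_mul_annulus (hωc : Continuous ω) (hω : ∀ g h, ω (h * g * h⁻¹) = ω g)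
    {m : ℕ} (hm : 1 ≤ m) (hper : r (2 * m) = r 0)
    (hinj : ∀ s t, s < 2 * m → t < 2 * m → r s = r t → s = t)
    (ha : ∀ t, Continuous (a t)) (hb : ∀ t, Continuous (b t))
    (hau : ∀ t s U z, a t (update U (r s) z) = a t U) (hbu : ∀ t s U z, b t (update U (r s) z) = b t U)
    {h : (ι → G) → ℂ} (hhm : Measurable h) {K : ℝ} (hhb : ∀ U, ‖h U‖ ≤ K)
    (hhu : ∀ s U z, h (update U (r s) z) = h U) :
    ∫ U, h U * ∏ s ∈ Finset.range (2 * m), plaqWt ω r a b s U ∂(piMeasure (ι := ι) (haarProbability G)) =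
      ∫ U, h U * (slabKernel (convPow ω m) (oprod a (2 * m) U) (oprod b (2 * m) U) : ℂ)
        ∂(piMeasure (ι := ι) (haarProbability G)) := by
  obtain ⟨C, hC0, hC⟩ := exists_forall_abs_le_of_continuous hωc
  set μ := piMeasure (ι := ι) (haarProbability G) with hμ
  set ψ := convPow ω m with hψ
  have hψc : Continuous ψ := continuous_convPow hωc m
  have hψz : ∀ g h, ψ (h * g * h⁻¹) = ψ g := convPow_central hω m
  -- distinctness facts
  have hr0m : r 0 ≠ r m := fun e => by have := hinj 0 m (by omega) (by omega) e; omega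
  have hinj1 : ∀ s t, s ≤ m → t ≤ m → r s = r t → s = t := fun s t hs ht e =>
    hinj s t (by omega) (by omega) e
  have hinj2 : ∀ s t, s ≤ m → t ≤ m → (fun t => r (m + t)) s = (fun t => r (m + t)) t → s = t := by
    intro s t hs ht e
    simp only at e
    rcases Nat.lt_or_ge s m with hs' | hs' <;> rcases Nat.lt_or_ge t m with ht' | ht'
    · have := hinj (m + s) (m + t) (by omega) (by omega) e; omega
    · have htm : t = m := le_antisymm ht ht'
      rw [htm, show m + m = 2 * m by ring, hper] at e
      have := hinj (m + s) 0 (by omega) (by omega) e; omega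
    · have hsm : s = m := le_antisymm hs hs'
      rw [hsm, show m + m = 2 * m by ring, hper] at e
      have := hinj 0 (m + t) (by omega) (by omega) e; omega
    · omega
  -- Step A: the first open chain, against `h₁ = h · (second half)`
  set h₁ : (ι → G) → ℂ := fun U => h U * ∏ s ∈ Finset.range m, plaqWt ω (fun t => r (m + t)) (fun t => a (m + t)) (fun t => b (m + t)) s U with hh₁
  have hsplit : ∀ U, h U * ∏ s ∈ Finset.range (2 * m), plaqWt ω r a b s U =
      h₁ U * ∏ s ∈ Finset.range m, plaqWt ω r a b s U := fun U => by
    rw [hh₁, show 2 * m = m + m by ring, ← Finset.prod_range_mul_prod_Ico _ (Nat.le_add_right m m),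
      Finset.prod_Ico_eq_prod_range, Nat.add_sub_cancel_left]
    simp_rw [plaqWt_shift]
    ring
  have hh₁m : Measurable h₁ :=
    hhm.mul (Finset.measurable_prod _ fun s _ => (continuous_plaqWt hωc (fun t => ha _) (fun t => hb _) s).measurable)
  have hh₁b : ∀ U, ‖h₁ U‖ ≤ K * C ^ m := fun U => by
    rw [hh₁, norm_mul, norm_prod]
    refine mul_le_mul (hhb U) ?_ (Finset.prod_nonneg fun _ _ => norm_nonneg _) ((norm_nonneg _).trans (hhb U))
    calc ∏ s ∈ Finset.range m, ‖plaqWt ω (fun t => r (m + t)) (fun t => a (m + t)) (fun t => b (m + t)) s U‖ ≤ ∏ _s ∈ Finset.range m, C :=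
          Finset.prod_le_prod (fun _ _ => norm_nonneg _) fun s _ => norm_plaqWt_le hC s U
      _ = C ^ m := by rw [Finset.prod_const, Finset.card_range]
  have hh₁u : ∀ s U z, 1 ≤ s → s < m → h₁ (update U (r s) z) = h₁ U := by
    intro s U z hs1 hsm
    simp only [hh₁]
    rw [hhu]
    congr 1
    refine Finset.prod_congr rfl fun t ht => ?_
    rw [Finset.mem_range] at ht
    refine plaqWt_update_of_ne ?_ ?_ (fun U z => hau _ _ U z) (fun U z => hbu _ _ U z) U z
    · show r (m + (t + 1)) ≠ r s
      intro e
      by_cases htop : m + (t + 1) = 2 * m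
      · rw [htop, hper] at e; have := hinj 0 s (by omega) (by omega) e; omega
      · have := hinj _ _ (by omega) (by omega) e; omega
    · show r (m + t) ≠ r s
      intro e; have := hinj _ _ (by omega) (by omega) e; omega
  simp_rw [hsplit]
  rw [integral_mul_openChain hωc hω hm hinj1 ha hb (fun t s U z _ _ => hau t s U z)
    (fun t s U z _ _ => hbu t s U z) hh₁m hh₁b hh₁u]
  -- Step B: the second open chain, against `h₂ = h · ψ(first half)`
  set F₁ : (ι → G) → G := fun U => oprod a m U * U (r m) * (oprod b m U)⁻¹ * (U (r 0))⁻¹ with hF₁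
  have hF₁c : Continuous F₁ :=
    (((continuous_oprod ha m).mul (continuous_apply _)).mul (continuous_oprod hb m).inv).mul (continuous_apply _).inv
  set h₂ : (ι → G) → ℂ := fun U => h U * (ψ (F₁ U) : ℂ) with hh₂
  have hsplit2 : ∀ U, h₁ U * (convPow ω m (oprod a m U * U (r m) * (oprod b m U)⁻¹ * (U (r 0))⁻¹) : ℂ) =
      h₂ U * ∏ s ∈ Finset.range m, plaqWt ω (fun t => r (m + t)) (fun t => a (m + t)) (fun t => b (m + t)) s U := fun U => by
    simp only [hh₁, hh₂, hF₁, hψ]; ring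
  obtain ⟨Cψ, hCψ⟩ := (isCompact_univ (X := G)).exists_bound_of_continuousOn hψc.continuousOn
  have hCψ' : ∀ g, ‖(ψ g : ℂ)‖ ≤ Cψ := fun g => by rw [Complex.norm_real]; exact hCψ g (Set.mem_univ _)
  have hh₂m : Measurable h₂ := hhm.mul (Complex.continuous_ofReal.comp (hψc.comp hF₁c)).measurable
  have hh₂b : ∀ U, ‖h₂ U‖ ≤ K * Cψ := fun U => by
    rw [hh₂, norm_mul]
    exact mul_le_mul (hhb U) (hCψ' _) (norm_nonneg _) ((norm_nonneg _).trans (hhb U))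
  have hh₂u : ∀ s U z, 1 ≤ s → s < m → h₂ (update U ((fun t => r (m + t)) s) z) = h₂ U := by
    intro s U z hs1 hsm
    have h0 : r 0 ≠ r (m + s) := fun e => by have := hinj _ _ (by omega) (by omega) e; omega
    have h1 : r m ≠ r (m + s) := fun e => by have := hinj _ _ (by omega) (by omega) e; omega
    simp only [hh₂, hF₁, hhu, oprod_update (fun t U z => hau t (m + s) U z),
      oprod_update (fun t U z => hbu t (m + s) U z), update_of_ne h0, update_of_ne h1]
  simp_rw [hsplit2]
  rw [integral_mul_openChain hωc hω hm hinj2 (fun t => ha _) (fun t => hb _) (fun t s U z _ _ => hau _ _ U z)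
    (fun t s U z _ _ => hbu _ _ U z) hh₂m hh₂b hh₂u]
  -- Step C: the rung `r m`
  have hr'm : r (m + m) = r 0 := by rw [show m + m = 2 * m by ring, hper]
  have hr'0 : r (m + 0) = r m := by rw [add_zero]
  simp_rw [hr'm, hr'0]
  set F₂ : (ι → G) → G := fun U =>
    oprod (fun t => a (m + t)) m U * U (r 0) * (oprod (fun t => b (m + t)) m U)⁻¹ * (U (r m))⁻¹ with hF₂
  have hF₂c : Continuous F₂ :=
    (((continuous_oprod (fun t => ha _) m).mul (continuous_apply _)).mul
      (continuous_oprod (fun t => hb _) m).inv).mul (continuous_apply _).inv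
  have hstepC : ∀ U, h₂ U * (convPow ω m (oprod (fun t => a (m + t)) m U * U (r 0) *
      (oprod (fun t => b (m + t)) m U)⁻¹ * (U (r m))⁻¹) : ℂ) = h U * ((ψ (F₁ U) : ℂ) * (ψ (F₂ U) : ℂ)) := fun U => by
    simp only [hh₂, hψ, hF₂]; ring
  simp_rw [hstepC]
  have hΦm : Measurable fun U => (ψ (F₁ U) : ℂ) * (ψ (F₂ U) : ℂ) :=
    ((Complex.continuous_ofReal.comp (hψc.comp hF₁c)).mul (Complex.continuous_ofReal.comp (hψc.comp hF₂c))).measurable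
  have hΦb : ∀ U, ‖(ψ (F₁ U) : ℂ) * (ψ (F₂ U) : ℂ)‖ ≤ Cψ * Cψ := fun U => by
    rw [norm_mul]
    have h1 := hCψ' (F₁ U)
    have h2 := hCψ' (F₂ U)
    exact mul_le_mul h1 h2 (norm_nonneg _) ((norm_nonneg _).trans h1)
  rw [integral_mul_eq_integral_mul_update (r m) hhm hΦm hhb hΦb (fun U z => hhu m U z)]
  have hinnerC : ∀ U, ∫ z, (ψ (F₁ (update U (r m) z)) : ℂ) * (ψ (F₂ (update U (r m) z)) : ℂ) ∂haarProbability G =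
      (haarConv ψ ψ (oprod a m U * oprod (fun t => a (m + t)) m U * U (r 0) * (oprod (fun t => b (m + t)) m U)⁻¹ * (oprod b m U)⁻¹ * (U (r 0))⁻¹) : ℂ) :=
    fun U => by
      have e : ∀ z, (ψ (F₁ (update U (r m) z)) : ℂ) * (ψ (F₂ (update U (r m) z)) : ℂ) =
          ((ψ (oprod a m U * z * (oprod b m U)⁻¹ * (U (r 0))⁻¹) *
            ψ (oprod (fun t => a (m + t)) m U * U (r 0) * (oprod (fun t => b (m + t)) m U)⁻¹ * z⁻¹) : ℝ) : ℂ) := fun z => by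
        simp only [hF₁, hF₂, oprod_update (fun t U z => hau t m U z), oprod_update (fun t U z => hbu t m U z),
          oprod_update (a := fun t => a (m + t)) (fun t U z => hau (m + t) m U z),
          oprod_update (a := fun t => b (m + t)) (fun t U z => hbu (m + t) m U z),
          update_self, update_of_ne hr0m, Complex.ofReal_mul]
      simp_rw [e]
      rw [integral_complex_ofReal, integral_mul_conv_step hψz hψz]
  simp_rw [hinnerC]
  -- Step D: the rung `r 0`
  have hF₃c : Continuous fun U : ι → G =>
      oprod a m U * oprod (fun t => a (m + t)) m U * U (r 0) * (oprod (fun t => b (m + t)) m U)⁻¹ * (oprod b m U)⁻¹ * (U (r 0))⁻¹ :=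
    ((((continuous_oprod ha m).mul (continuous_oprod (fun t => ha _) m)).mul (continuous_apply _)).mul
      (continuous_oprod (fun t => hb _) m).inv).mul (continuous_oprod hb m).inv |>.mul (continuous_apply _).inv
  have hψψc : Continuous (haarConv ψ ψ) :=
    continuous_haarConv hψc (hψc.integrable_of_hasCompactSupport (HasCompactSupport.of_compactSpace _))
  obtain ⟨C₂, hC₂⟩ := (isCompact_univ (X := G)).exists_bound_of_continuousOn hψψc.continuousOn
  have hΦ'm : Measurable fun U : ι → G =>
      (haarConv ψ ψ (oprod a m U * oprod (fun t => a (m + t)) m U * U (r 0) * (oprod (fun t => b (m + t)) m U)⁻¹ * (oprod b m U)⁻¹ * (U (r 0))⁻¹) : ℂ) :=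
    (Complex.continuous_ofReal.comp (hψψc.comp hF₃c)).measurable
  rw [integral_mul_eq_integral_mul_update (r 0) hhm hΦ'm hhb
    (fun U => by rw [Complex.norm_real]; exact hC₂ _ (Set.mem_univ _)) (fun U z => hhu 0 U z)]
  refine integral_congr_ae (ae_of_all _ fun U => ?_)
  dsimp only
  congr 1
  simp only [oprod_update (fun t U z => hau t 0 U z), oprod_update (fun t U z => hbu t 0 U z),
    oprod_update (a := fun t => a (m + t)) (fun t U z => hau (m + t) 0 U z),
    oprod_update (a := fun t => b (m + t)) (fun t U z => hbu (m + t) 0 U z), update_self]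
  rw [integral_complex_ofReal, slabKernel, show 2 * m = m + m by ring, oprod_add, oprod_add]
  congr 2
  funext x
  congr 1
  simp only [mul_inv_rev, mul_assoc]

end SlabKernel

end Summit.QuantumFields.GaugeBoot

end
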